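import Summits.ABC.ABC.Theses.IsogenyGlueCongruence
import Literature.NumberTheory.DiophantineGeometry.LocalReduction
import Literature.NumberTheory.DiophantineGeometry.MinimalDiscriminant

/-!
# Sketch — crux-ideate stmt-ABC-13919 (EllipticGluingPrimeBound), ideator 1, round 1

First-lemma signatures of the idea cards `kronecker-correlation-lift` and
`hyperbolic-repulsion-transplant` (and the common Step 0).  Statements only (`def … : Prop`);
nothing here is proved or claimed.  Everything is stated over existing declarations of the tree.
-/

namespace Summit.ABC.ABC.Cruxes.EllipticGluingPrimeBound.SketchIdeator1

open Literature.AlgebraicGeometry.Motives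
open CategoryTheory

/-- Iterated self-product `A^{(n+1)}` (helper for "geometrically `E`-isotypic"; `npow A 0 = A`). -/
noncomputable def npow {K : Type} [Field K] (A : AbelianVariety.{0} K) : ℕ → AbelianVariety.{0} K
  | 0 => A
  | n + 1 => (npow A n).prod A

/-- STEP 0 (common to every line; the crux-attack refuter's structural reduction, here as a
statement to be proved): if `E` is an isogeny factor of `B` and the prime `ℓ > 163` divides every
`E`-multiplier of `B`, then `E[ℓ] = W[ℓ]` embeds `Γ_ℚ`-equivariantly into an abelian variety `A`
over `ℚ` of smaller dimension admitting no non-zero morphism from `E` (a "partner").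
(`163 <` makes `W[ℓ]` irreducible by Mazur; smaller primes are absorbed in the constant of U.) -/
def MultiplierToGluing : Prop :=
  ∀ (W : WeierstrassCurve ℚ) [W.IsElliptic] (E B : AbelianVariety.{0} ℚ)
    (e : E.geomPoints ≃+ W.geomPoints),
    (∀ (σ : Field.absoluteGaloisGroup ℚ) (P : E.geomPoints), e (σ • P) = σ • e P) →
    ∀ ℓ : ℕ, ℓ.Prime → 163 < ℓ →
    (∃ (α : E ⟶ B) (β : B ⟶ E) (n : ℤ), n ≠ 0 ∧ α ≫ β = n • 𝟙 E) →
    (∀ (α : E ⟶ B) (β : B ⟶ E) (n : ℤ), α ≫ β = n • 𝟙 E → (ℓ : ℤ) ∣ n) →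
    ∃ (A : AbelianVariety.{0} ℚ), A.dim < B.dim ∧ (∀ f : E ⟶ A, f = 0) ∧
      ∃ ι : W.geomTorsion ℓ →+ A.geomPoints, Function.Injective ι ∧
        ∀ (σ : Field.absoluteGaloisGroup ℚ) (P : W.geomTorsion ℓ), ι (σ • P) = σ • ι P

/-- CARD `kronecker-correlation-lift`, Stage 1 (regime I, claimed PROVABLE NOW): on partners that
are geometrically of `E`-type (over some number field `L`, `B_L` is isogenous to a power of `E_L`)
the crux holds with the explicit shape `ℓ ≤ 2·dim B + 1` or `ℓ ≤ C·max(1,h_F(W))²`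
(Minkowski / Feit–Tits–Landazuri–Seitz / effective surjectivity of `ρ̄_{E,ℓ}`). -/
def TwistClassBound : Prop :=
  ∃ C : ℝ, ∀ (W : WeierstrassCurve ℚ) [W.IsElliptic] (E B : AbelianVariety.{0} ℚ)
    (e : E.geomPoints ≃+ W.geomPoints),
    (∀ (σ : Field.absoluteGaloisGroup ℚ) (P : E.geomPoints), e (σ • P) = σ • e P) →
    (∃ (L : Type) (_ : Field L) (_ : NumberField L) (_ : Algebra ℚ L) (m : ℕ),
        AbelianVariety.IsIsogenous (B.baseChange L) (npow (E.baseChange L) m)) →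
    ∀ ℓ : ℕ, ℓ.Prime →
    (∃ (α : E ⟶ B) (β : B ⟶ E) (n : ℤ), n ≠ 0 ∧ α ≫ β = n • 𝟙 E) →
    (∀ (α : E ⟶ B) (β : B ⟶ E) (n : ℤ), α ≫ β = n • 𝟙 E → (ℓ : ℤ) ∣ n) →
    (ℓ ≤ 2 * B.dim + 1 ∨ (ℓ : ℝ) ≤ C * (max 1 W.stableFaltingsHeight) ^ 2)

/-- The group-theoretic kernel of Stage 1 (Minkowski 1887): an element of prime order `ℓ` in
`GL_m(ℤ)` forces `ℓ ≤ m + 1` (its characteristic polynomial has a primitive `ℓ`-th root of unity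
as a root, so `φ(ℓ) = ℓ - 1 ≤ m`).  Pure Mathlib statement. -/
def MinkowskiPrimeOrder : Prop :=
  ∀ (m ℓ : ℕ) (g : Matrix.GeneralLinearGroup (Fin m) ℤ), ℓ.Prime → orderOf g = ℓ → ℓ ≤ m + 1

/-- CARD `kronecker-correlation-lift`, Stage 2 shadow (qualitative, per pair; KNOWN in substance —
Masser–Wüstholz / Gaudron–Rémond per pair, or Lemma K + Hui–Larsen): for a FIXED elliptic `W` and a
FIXED partner `A` with no morphism from `E` over any number field, only finitely many primes glue.
The card's content is the EFFECTIVE version with threshold `C (dim A · max(1,h_F W))^κ`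
independent of `A`'s height. -/
def PairwiseGluingFiniteness : Prop :=
  ∀ (W : WeierstrassCurve ℚ) [W.IsElliptic] (E A : AbelianVariety.{0} ℚ)
    (e : E.geomPoints ≃+ W.geomPoints),
    (∀ (σ : Field.absoluteGaloisGroup ℚ) (P : E.geomPoints), e (σ • P) = σ • e P) →
    (∀ (L : Type) (_ : Field L) (_ : NumberField L) (_ : Algebra ℚ L)
        (f : E.baseChange L ⟶ A.baseChange L), f = 0) →
    ∃ ℓ₀ : ℕ, ∀ ℓ : ℕ, ℓ.Prime → ℓ₀ < ℓ →
      ∀ ι : W.geomTorsion ℓ →+ A.geomPoints,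
        (∀ (σ : Field.absoluteGaloisGroup ℚ) (P : W.geomTorsion ℓ), ι (σ • P) = σ • ι P) →
        Function.Injective ι → False

/-- CARD `hyperbolic-repulsion-transplant`, first arithmetic lemma ("cusp proximity is free";
Tate curve): if `W` has good reduction and `W'` multiplicative reduction at a finite place `v ∤ ℓ`
of `ℚ`, and `W[ℓ] ≅ W'[ℓ]` `Γ_ℚ`-equivariantly, then `ℓ ∣ ord_v Δ_min(W')`.  This is the
number-field shadow of the fact that in Bakker–Tsimerman the boundary (cusp) term of the repulsion
inequality is paid for by the level structure itself. -/
def CuspProximityFree : Prop :=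
  ∀ (W W' : WeierstrassCurve ℚ) [W.IsElliptic] [W'.IsElliptic] (ℓ : ℕ), ℓ.Prime →
    ∀ v : IsDedekindDomain.HeightOneSpectrum ℤ, v.asIdeal ≠ Ideal.span {(ℓ : ℤ)} →
    W.HasGoodReductionAt v → W'.HasMultiplicativeReductionAt v →
    (∃ f : W.geomTorsion ℓ ≃+ W'.geomTorsion ℓ,
        ∀ (σ : Field.absoluteGaloisGroup ℚ) (P : W.geomTorsion ℓ), f (σ • P) = σ • f P) →
    ℓ ∣ W'.ordMinimalDiscriminant v

end Summit.ABC.ABC.Cruxes.EllipticGluingPrimeBound.SketchIdeator1
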